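import Literature.Geometry.Riemannian.KillingHopfPositive
import Literature.Topology.FourManifolds.PoincareThreeClassification
import HarnessLib

/-!
# Compact manifolds of constant positive curvature are spherical space forms
(topic `Geometry/Riemannian`)

The Killing–Hopf theorem in quotient form (`KillingHopf.exists_orthogonal_quotient`,
`KillingHopfPositive.lean`; Lee 2018, Thm. 12.4 with Cor. 12.5) read in the vocabulary of
`Literature/Topology/FourManifolds/PoincareThreeClassification.lean`: a compact connected smooth
`n`-manifold (`n ≥ 2`, charts in `ℝⁿ`) carrying a `C^∞` Riemannian metric of constant sectional
curvature `c > 0` is a **spherical space form** `IsSphericalSpaceForm n M` — the quotient of the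
round `𝕊ⁿ ⊂ ℝⁿ⁺¹` by a finite group of linear isometries of `ℝⁿ⁺¹` acting freely (Morgan–Tian 2007,
Introduction: "the quotients of `S³` by free, linear actions of finite subgroups of the orthogonal
group `O(4)`"; Wolf, *Spaces of constant curvature*, Thm. 2.4.9 / §2.5). PROVED; no named facts.

## References

* J. M. Lee, *Introduction to Riemannian Manifolds*, 2nd ed. (2018), Thm. 12.4, Cor. 12.5. [Lee2018]
* J. Morgan, G. Tian, *Ricci flow and the Poincaré conjecture* (2007), Introduction. [MorganTian2007]
* J. A. Wolf, *Spaces of constant curvature*, 6th ed. (2011), §2.4–2.5. [Wolf2011]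
-/

noncomputable section

open Set Function Metric Module
open scoped Manifold ContDiff

namespace Literature.Geometry.Riemannian

open Lorentzian Lorentzian.PseudoRiemannianMetric

/-- **A compact connected Riemannian `n`-manifold (`n ≥ 2`) of constant sectional curvature
`c > 0` is a spherical space form** `𝕊ⁿ/Γ`, `Γ ≤ O(n+1)` finite acting freely
(`Literature.Topology.FourManifolds.IsSphericalSpaceForm`). Lee 2018, Thm. 12.4 (Killing–Hopf)
with Cor. 12.5, via `KillingHopf.exists_orthogonal_quotient`.
[cite: Lee2018, Thm. 12.4 and Cor. 12.5] -/
theorem isSphericalSpaceForm_of_constantCurvature {n : ℕ} (hn : 2 ≤ n) (M : Type*)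
    [TopologicalSpace M] [T2Space M] [CompactSpace M] [ConnectedSpace M]
    [ChartedSpace (EuclideanSpace ℝ (Fin n)) M] [IsManifold (𝓡 n) ∞ M] {c : ℝ} (hc : 0 < c)
    (g : PseudoRiemannianMetric (𝓡 n) ∞ (EuclideanSpace ℝ (Fin n)) (TangentSpace (𝓡 n) : M → Type _))
    (hg : g.IsRiemannian) (hK : g.HasConstantSectionalCurvature c) :
    Literature.Topology.FourManifolds.IsSphericalSpaceForm n M := by
  haveI : Fact (finrank ℝ (EuclideanSpace ℝ (Fin (n + 1))) = n + 1) := ⟨finrank_euclideanSpace_fin⟩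
  have p : Metric.sphere (0 : EuclideanSpace ℝ (Fin (n + 1))) 1 :=
    ⟨EuclideanSpace.single 0 1, by simp⟩
  obtain ⟨Γ, q, hfin, hfree, hloc, hsurj, hfib⟩ :=
    KillingHopf.exists_orthogonal_quotient (V := EuclideanSpace ℝ (Fin (n + 1))) (n := n) hn hc hg
      hK finrank_euclideanSpace_fin p
  refine ⟨Γ, hfin, fun γ hγ x hx ↦ ?_, q, hloc, hsurj, fun x y ↦ ?_⟩
  · by_contra hne
    exact hfree γ hγ hne x hx
  · rw [eq_comm, hfib y x]

end Literature.Geometry.Riemannian
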